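import Mathlib
import Literature.Analysis.FluidPDE.ClassicalSolution
import Literature.Analysis.FluidPDE.LerayHopf
import Literature.Analysis.FluidPDE.TaoLocalisation
import Literature.Analysis.FluidPDE.RieszPressureSpaceTimeLp
import Summits.NavierStokesRegularity.NavierStokesRegularity.Theses.L3TimeExponentPincer
import Summits.NavierStokesRegularity.NavierStokesRegularity.Theorems.L3TimeExponentPincerEffNode
import Summits.NavierStokesRegularity.NavierStokesRegularity.Theorems.L3TimeExponentPincerPaceDichotomy
import Summits.NavierStokesRegularity.NavierStokesRegularity.Theorems.L3TimeExponentPincerEffSatBlowupStubParabolicConcentrationBlowup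
import Summits.NavierStokesRegularity.NavierStokesRegularity.Theorems.L3TimeExponentPincerMorreyOneScaleSlice
import HarnessLib.Audit
import HarnessLib

/-!
# On the Morrey-Type-I class, Type-I DISSIPATION implies the `L³`-Type-I pace (stub 2 of line `pace`) —
# crux `EffSatBlowup` (route `L3TimeExponentPincer`, item `stmt-NavierStokesRegularity-19139`)

Support file (seat ns-pincer-19139-p1, lead of line `pace`; `--supports stmt-NavierStokesRegularity-19139
--as helper`), frame corollaries of the one-scale localized interpolation inequality
`L3TimeExponentPincerMorreyOneScaleSlice.exists_lintegral_cube_le_of_morrey_oneScale`.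

* §1 `l3Slice_of_morreyTypeINear` — **unconditional slice inequality on stub 2's class**: for a classical
  solution on `[0,T)`, Leray–Hopf on `[0,T)`, of the class `MorreyTypeINear u T` (`∫_{B(x,r)}|u(t)|² ≤ M r`,
  `r < r₁`, `T - r² < t < T`), there is a final window on which, at EVERY time `t`, with `s = T - t`,
  `‖u(t)‖₃³ ≤ C₀ (2M√s)^{1/2} (2E₀)^{1/4} (‖∇u(t)‖₂² + (4s)⁻¹ · 2E₀)^{3/4}`
  (the inequality at the single radius `ρ = 2√s`, which lies in the top window since `ρ² = 4s > s`; `E₀` the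
  initial kinetic energy).  So the `L³` size at time `t` is controlled by the DISSIPATION at time `t` alone.
* §2 `l3Slow_of_morreyTypeINear_of_dissipationTypeI` — **Type-I dissipation ⇒ stub 2's conclusion**: if moreover
  `‖∇u(t)‖₂² ≤ D₀/(T-t)` on a final window, then `L3Slow u T` (`‖u(t)‖₃³ ≤ A/√(T-t)`).  Note that the
  self-similar rate of `‖∇u(t)‖₂²` is `(T-t)^{-1/2}`: the hypothesis allows TWICE the self-similar exponent, and
  its failure set `{t : ‖∇u(t)‖₂² > D₀/(T-t)}` is log-null for every Leray–Hopf solution (`∫‖∇u‖₂² < ∞`).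
* §3 `effSatNear_of_morreyTypeINear_of_dissipationTypeI` — on the blow-up branch, with the landed stub 1
  (`effSatNear_of_blowup_of_l3Slow`, p423422): Morrey-Type-I + Type-I dissipation ⇒ the crux clause `K₃(1)`;
  `stub2_of_dissipationTypeI` — the registered stub `stub_morreyTypeI_slow` with ONE extra hypothesis
  (Type-I dissipation), i.e. the candidate reshaped stub «2b» proved, leaving «2a»: Morrey-Type-I frame blow-ups
  have Type-I dissipation.

Placement (honest): this re-cuts stub 2 (`MorreyTypeINear ⇒ L3Slow`, open in print) into the dissipation-rate
statement 2a «Morrey-Type-I frame blow-ups have `‖∇u(t)‖₂² ≲ (T-t)⁻¹` near `T`» (open in print; for sup-Type-I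
blow-ups stub 2 holds trivially, so 2a is only needed off that class) and the PROVED bridge 2b; nsreg-p4 g4/g5
reached the analogous bridge only on the Full/Sub-parabolic Morrey classes (p445696), not on stub 2's own class
`MorreyTypeINear` (their gap (b): «scales ρ < √(T-t) missing» — here the gradient handles those scales).

WHAT THIS IS NOT: not a claim about Navier–Stokes regularity or blow-up; elementary consequences of a kernel-checked
interpolation inequality in the route's frame, landed `--supports`; the crux and stubs 2–3 stay open.

References: L. Caffarelli, R. Kohn, L. Nirenberg, CPAM 35 (1982), §2 [CaffarelliKohnNirenberg1982]; T. Barker,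
C. Prange, ARMA 236 (2020) = arXiv:1812.09115, (1.7) [BarkerPrange2020]; J. Leray, Acta Math. 63 (1934)
[Leray1934].
-/

noncomputable section

open MeasureTheory Set Function Filter Metric Topology TopologicalSpace
open scoped ENNReal NNReal Topology
open Literature.Analysis.FluidPDE
open Summit.NavierStokesRegularity.NavierStokesRegularity.Theorems.L3TimeExponentPincerEffNode
open Summit.NavierStokesRegularity.NavierStokesRegularity.Theorems.L3TimeExponentPincerPaceDichotomy
open Summit.NavierStokesRegularity.NavierStokesRegularity.Theorems.L3TimeExponentPincerStubParabolicConcentration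
open Summit.NavierStokesRegularity.NavierStokesRegularity.Theorems.L3TimeExponentPincerMorreyOneScaleSlice

namespace Summit.NavierStokesRegularity.NavierStokesRegularity.Theorems.L3TimeExponentPincerMorreyTypeIDissipationPace

variable {ν T : ℝ} {u : ℝ → EuclideanSpace ℝ (Fin 3) → EuclideanSpace ℝ (Fin 3)}
  {p : ℝ → EuclideanSpace ℝ (Fin 3) → ℝ}

/-! ## §1  The slice inequality at every late time of a Morrey-Type-I frame solution -/

/-- **Slice inequality on the Morrey-Type-I class.**  For a classical solution on `[0,T)`, Leray–Hopf on `[0,T)`,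
with `MorreyTypeINear u T`, there are an absolute `C₀`, the Morrey constant `M` and a time `T₁ < T` such that for
every `t ∈ (T₁, T)`, writing `s = T - t` and `E₀ = 2·(kinetic energy of u(0))`:
`∫|u(t)|³ ≤ C₀ (M·2√s)^{1/2} E₀^{1/4} (∫|∇u(t)|² + (4s)⁻¹ E₀)^{3/4}`
(`exists_lintegral_cube_le_of_morrey_oneScale` at the radius `ρ = 2√s < r₁`, inside the top window `T - ρ² < t`,
and the Leray energy bound). [cite: CaffarelliKohnNirenberg1982, §2 (2.8)–(2.10)] -/
theorem l3Slice_of_morreyTypeINear (hν : 0 < ν) (hT : 0 < T)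
    (hsol : IsClassicalNSSolutionOn (Ico 0 T) ν 0 u p) (hLH : IsLerayHopfOn T ν 0 (u 0) u)
    (hMor : MorreyTypeINear u T) :
    ∃ C₀ : ℝ≥0, ∃ M : ℝ, 0 < M ∧ ∃ T₁ < T, ∀ t ∈ Ioo T₁ T,
      ∫⁻ x, ‖u t x‖ₑ ^ (3 : ℕ) ≤
        C₀ * ENNReal.ofReal (M * (2 * Real.sqrt (T - t))) ^ (1 / 2 : ℝ) *
          ENNReal.ofReal (2 * VectorCalculus.kineticEnergy (u 0)) ^ (1 / 4 : ℝ) *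
          ((∫⁻ x, ENNReal.ofReal (frobeniusNormSq (fderiv ℝ (u t) x))) +
            (ENNReal.ofReal ((2 * Real.sqrt (T - t)) ^ 2))⁻¹ *
              ENNReal.ofReal (2 * VectorCalculus.kineticEnergy (u 0))) ^ (3 / 4 : ℝ) := by
  obtain ⟨C₀, hC₀⟩ := exists_lintegral_cube_le_of_morrey_oneScale
  obtain ⟨M, hM, r₁, hr₁, hMr⟩ := hMor
  refine ⟨C₀, M, hM, max (T / 2) (T - r₁ ^ 2 / 8), max_lt (by linarith) (by nlinarith), fun t ht => ?_⟩
  have ht2 : T / 2 < t := lt_of_le_of_lt (le_max_left _ _) ht.1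
  have ht8 : T - r₁ ^ 2 / 8 < t := lt_of_le_of_lt (le_max_right _ _) ht.1
  have ht0 : 0 < t := by linarith
  have htT : t < T := ht.2
  set s : ℝ := T - t with hs
  have hspos : 0 < s := by rw [hs]; linarith
  set ρ : ℝ := 2 * Real.sqrt s with hρ
  have hsq : Real.sqrt s ^ 2 = s := Real.sq_sqrt hspos.le
  have hρpos : 0 < ρ := by rw [hρ]; positivity
  have hρ2 : ρ ^ 2 = 4 * s := by rw [hρ, mul_pow, hsq]; norm_num
  have hρr₁ : ρ < r₁ := by
    have h1 : ρ ^ 2 < r₁ ^ 2 := by rw [hρ2, hs]; linarith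
    exact lt_of_pow_lt_pow_left₀ 2 hr₁.le h1
  have hwin : T - ρ ^ 2 < t := by rw [hρ2, hs]; linarith
  -- the slice `u t` is `C¹` and Morrey-bounded at the radius `ρ`
  have hC1 : ContDiff ℝ 1 (u t) := (hsol.contDiff_velocity ⟨ht0.le, htT⟩).of_le (by norm_cast)
  have hMρ : ∀ x : EuclideanSpace ℝ (Fin 3), ∫⁻ y in ball x ρ, ‖u t y‖ₑ ^ (2 : ℕ) ≤ ENNReal.ofReal (M * ρ) :=
    fun x => hMr x ρ hρpos hρr₁ t hwin htT
  have hmain := hC₀ (u t) hC1 ρ M hρpos hM.le hMρ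
  -- the energy bound
  have hE : ∫⁻ y, ‖u t y‖ₑ ^ (2 : ℕ) ≤ ENNReal.ofReal (2 * VectorCalculus.kineticEnergy (u 0)) :=
    hLH.lintegral_enorm_sq_le hν.le ⟨ht0.le, htT.le⟩
  calc ∫⁻ x, ‖u t x‖ₑ ^ (3 : ℕ)
      ≤ C₀ * ENNReal.ofReal (M * ρ) ^ (1 / 2 : ℝ) * (∫⁻ y, ‖u t y‖ₑ ^ (2 : ℕ)) ^ (1 / 4 : ℝ) *
          ((∫⁻ y, ENNReal.ofReal (frobeniusNormSq (fderiv ℝ (u t) y))) +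
            (ENNReal.ofReal (ρ ^ 2))⁻¹ * ∫⁻ y, ‖u t y‖ₑ ^ (2 : ℕ)) ^ (3 / 4 : ℝ) := hmain
    _ ≤ C₀ * ENNReal.ofReal (M * ρ) ^ (1 / 2 : ℝ) *
          ENNReal.ofReal (2 * VectorCalculus.kineticEnergy (u 0)) ^ (1 / 4 : ℝ) *
          ((∫⁻ y, ENNReal.ofReal (frobeniusNormSq (fderiv ℝ (u t) y))) +
            (ENNReal.ofReal (ρ ^ 2))⁻¹ * ENNReal.ofReal (2 * VectorCalculus.kineticEnergy (u 0))) ^ (3 / 4 : ℝ) :=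
        mul_le_mul' (mul_le_mul' le_rfl (ENNReal.rpow_le_rpow hE (by norm_num)))
          (ENNReal.rpow_le_rpow (add_le_add le_rfl (mul_le_mul' le_rfl hE)) (by norm_num))

/-! ## §2  Type-I dissipation on the Morrey-Type-I class gives the `L³`-Type-I pace -/

/-- Real arithmetic of the exponents: `(M·2q)^{1/2} E^{1/4} (K/q²)^{3/4} = (2M)^{1/2} E^{1/4} K^{3/4} / q`
for `q > 0`. [folklore] -/
theorem scaling_real_identity {M E K q : ℝ} (hM : 0 ≤ M) (hK : 0 ≤ K) (hq : 0 < q) :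
    (M * (2 * q)) ^ (1 / 2 : ℝ) * E ^ (1 / 4 : ℝ) * (K / q ^ 2) ^ (3 / 4 : ℝ) =
      (2 * M) ^ (1 / 2 : ℝ) * E ^ (1 / 4 : ℝ) * K ^ (3 / 4 : ℝ) / q := by
  have hq0 : 0 ≤ q := hq.le
  have h1 : (M * (2 * q)) ^ (1 / 2 : ℝ) = (2 * M) ^ (1 / 2 : ℝ) * q ^ (1 / 2 : ℝ) := by
    rw [show M * (2 * q) = (2 * M) * q by ring, Real.mul_rpow (by positivity) hq0]
  have h2 : (K / q ^ 2) ^ (3 / 4 : ℝ) = K ^ (3 / 4 : ℝ) / q ^ (3 / 2 : ℝ) := by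
    rw [Real.div_rpow hK (by positivity), show (q ^ 2 : ℝ) = q ^ (2 : ℝ) by norm_cast,
      ← Real.rpow_mul hq0]
    norm_num
  have h3 : q ^ (1 / 2 : ℝ) / q ^ (3 / 2 : ℝ) = 1 / q := by
    rw [div_eq_iff (Real.rpow_pos_of_pos hq _).ne', show (3 / 2 : ℝ) = 1 / 2 + 1 by norm_num,
      Real.rpow_add hq, Real.rpow_one]
    field_simp
  rw [h1, h2]
  calc (2 * M) ^ (1 / 2 : ℝ) * q ^ (1 / 2 : ℝ) * E ^ (1 / 4 : ℝ) * (K ^ (3 / 4 : ℝ) / q ^ (3 / 2 : ℝ))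
      = (2 * M) ^ (1 / 2 : ℝ) * E ^ (1 / 4 : ℝ) * K ^ (3 / 4 : ℝ) * (q ^ (1 / 2 : ℝ) / q ^ (3 / 2 : ℝ)) := by
        ring
    _ = (2 * M) ^ (1 / 2 : ℝ) * E ^ (1 / 4 : ℝ) * K ^ (3 / 4 : ℝ) / q := by rw [h3]; ring

/-- **Morrey-Type-I + Type-I dissipation ⇒ `L³`-slow.**  For a classical solution on `[0,T)`, Leray–Hopf on `[0,T)`,
of the class `MorreyTypeINear u T`, a Type-I DISSIPATION bound `∫|∇u(t)|² ≤ D₀/(T-t)` on a final window implies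
the `L³`-Type-I pace `‖u(t)‖₃³ ≤ A/√(T-t)` on a final window (`L3Slow u T`), with
`A = C₀ (2M)^{1/2} (2E₀)^{1/4} (D₀ + E₀/2)^{3/4} + 1`. [cite: CaffarelliKohnNirenberg1982, §2 (2.8)–(2.10)] -/
theorem l3Slow_of_morreyTypeINear_of_dissipationTypeI (hν : 0 < ν) (hT : 0 < T)
    (hsol : IsClassicalNSSolutionOn (Ico 0 T) ν 0 u p) (hLH : IsLerayHopfOn T ν 0 (u 0) u)
    (hMor : MorreyTypeINear u T)
    (hD : ∃ D₀ : ℝ, 0 < D₀ ∧ ∃ T₂ < T, ∀ t ∈ Ioo T₂ T,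
      ∫⁻ x, ENNReal.ofReal (frobeniusNormSq (fderiv ℝ (u t) x)) ≤ ENNReal.ofReal (D₀ / (T - t))) :
    L3Slow u T := by
  obtain ⟨C₀, M, hM, T₁, hT₁, hslice⟩ := l3Slice_of_morreyTypeINear hν hT hsol hLH hMor
  obtain ⟨D₀, hD₀, T₂, hT₂, hDt⟩ := hD
  set E₀ : ℝ := 2 * VectorCalculus.kineticEnergy (u 0) with hE₀
  have hE₀ : 0 ≤ E₀ := mul_nonneg zero_le_two (Literature.Analysis.FluidPDE.kineticEnergy_nonneg _)
  set K : ℝ := D₀ + E₀ / 4 with hK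
  have hKpos : 0 < K := by rw [hK]; positivity
  set A : ℝ := (C₀ : ℝ) * ((2 * M) ^ (1 / 2 : ℝ) * E₀ ^ (1 / 4 : ℝ) * K ^ (3 / 4 : ℝ)) + 1 with hA
  have hA1 : (C₀ : ℝ) * ((2 * M) ^ (1 / 2 : ℝ) * E₀ ^ (1 / 4 : ℝ) * K ^ (3 / 4 : ℝ)) ≤ A := by
    rw [hA]; linarith
  have hApos : 0 < A := by rw [hA]; positivity
  refine ⟨A, hApos, max T₁ T₂, max_lt hT₁ hT₂, fun t ht => ?_⟩
  have ht₁ : t ∈ Ioo T₁ T := ⟨lt_of_le_of_lt (le_max_left _ _) ht.1, ht.2⟩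
  have ht₂ : t ∈ Ioo T₂ T := ⟨lt_of_le_of_lt (le_max_right _ _) ht.1, ht.2⟩
  set s : ℝ := T - t with hs
  have hspos : 0 < s := by rw [hs]; linarith [ht.2]
  set q : ℝ := Real.sqrt s with hq
  have hqpos : 0 < q := Real.sqrt_pos.2 hspos
  have hq2 : q ^ 2 = s := Real.sq_sqrt hspos.le
  have h1 := hslice t ht₁
  have h2 := hDt t ht₂
  -- `∫|u(t)|³ = ‖u(t)‖₃³`
  have h3 : eLpNorm (u t) 3 volume ^ (3 : ℝ) = ∫⁻ x, ‖u t x‖ₑ ^ (3 : ℕ) := by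
    rw [← lintegral_enorm_rpow_three_eq_eLpNorm_rpow]
    refine lintegral_congr fun x => ?_
    rw [← ENNReal.rpow_natCast]
    norm_num
  rw [h3]
  rw [← hq] at h1
  refine h1.trans ?_
  -- bound the dissipation and collect everything into one `ofReal`
  have h4 : (∫⁻ x, ENNReal.ofReal (frobeniusNormSq (fderiv ℝ (u t) x))) +
      (ENNReal.ofReal ((2 * q) ^ 2))⁻¹ * ENNReal.ofReal E₀ ≤ ENNReal.ofReal (K / q ^ 2) := by
    have e1 : (2 * q) ^ 2 = 4 * q ^ 2 := by ring
    rw [e1, ← ENNReal.ofReal_inv_of_pos (by positivity), ← ENNReal.ofReal_mul (by positivity)]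
    have h2' : ∫⁻ x, ENNReal.ofReal (frobeniusNormSq (fderiv ℝ (u t) x)) ≤ ENNReal.ofReal (D₀ / q ^ 2) := by
      rw [hq2, hs]; exact h2
    calc (∫⁻ x, ENNReal.ofReal (frobeniusNormSq (fderiv ℝ (u t) x))) + ENNReal.ofReal ((4 * q ^ 2)⁻¹ * E₀)
        ≤ ENNReal.ofReal (D₀ / q ^ 2) + ENNReal.ofReal ((4 * q ^ 2)⁻¹ * E₀) := by gcongr
      _ = ENNReal.ofReal (K / q ^ 2) := by
          rw [← ENNReal.ofReal_add (by positivity) (by positivity), hK]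
          congr 1
          field_simp
  -- the three `rpow`s of `ofReal`s as `ofReal`s of real `rpow`s
  have eM : ENNReal.ofReal (M * (2 * q)) ^ (1 / 2 : ℝ) = ENNReal.ofReal ((M * (2 * q)) ^ (1 / 2 : ℝ)) :=
    ENNReal.ofReal_rpow_of_nonneg (by positivity) (by norm_num)
  have eE : ENNReal.ofReal E₀ ^ (1 / 4 : ℝ) = ENNReal.ofReal (E₀ ^ (1 / 4 : ℝ)) :=
    ENNReal.ofReal_rpow_of_nonneg hE₀ (by norm_num)
  have eK : ENNReal.ofReal (K / q ^ 2) ^ (3 / 4 : ℝ) = ENNReal.ofReal ((K / q ^ 2) ^ (3 / 4 : ℝ)) :=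
    ENNReal.ofReal_rpow_of_nonneg (by positivity) (by norm_num)
  have hx1 : 0 ≤ (C₀ : ℝ) := NNReal.coe_nonneg C₀
  have hx2 : 0 ≤ (C₀ : ℝ) * (M * (2 * q)) ^ (1 / 2 : ℝ) := by positivity
  have hx3 : 0 ≤ (C₀ : ℝ) * (M * (2 * q)) ^ (1 / 2 : ℝ) * E₀ ^ (1 / 4 : ℝ) := by positivity
  calc (C₀ : ℝ≥0∞) * ENNReal.ofReal (M * (2 * q)) ^ (1 / 2 : ℝ) * ENNReal.ofReal E₀ ^ (1 / 4 : ℝ) *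
        ((∫⁻ x, ENNReal.ofReal (frobeniusNormSq (fderiv ℝ (u t) x))) +
          (ENNReal.ofReal ((2 * q) ^ 2))⁻¹ * ENNReal.ofReal E₀) ^ (3 / 4 : ℝ)
      ≤ (C₀ : ℝ≥0∞) * ENNReal.ofReal (M * (2 * q)) ^ (1 / 2 : ℝ) * ENNReal.ofReal E₀ ^ (1 / 4 : ℝ) *
          (ENNReal.ofReal (K / q ^ 2)) ^ (3 / 4 : ℝ) :=
        mul_le_mul' le_rfl (ENNReal.rpow_le_rpow h4 (by norm_num))
    _ = ENNReal.ofReal ((C₀ : ℝ) * (M * (2 * q)) ^ (1 / 2 : ℝ) * E₀ ^ (1 / 4 : ℝ) * (K / q ^ 2) ^ (3 / 4 : ℝ)) := by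
        rw [eM, eE, eK, ← ENNReal.ofReal_coe_nnreal, ← ENNReal.ofReal_mul hx1, ← ENNReal.ofReal_mul hx2,
          ← ENNReal.ofReal_mul hx3]
    _ = ENNReal.ofReal ((C₀ : ℝ) * ((2 * M) ^ (1 / 2 : ℝ) * E₀ ^ (1 / 4 : ℝ) * K ^ (3 / 4 : ℝ)) / q) := by
        rw [mul_div_assoc, ← scaling_real_identity (E := E₀) hM.le hKpos.le hqpos]
        congr 1
        ring
    _ ≤ ENNReal.ofReal (A / q) :=
        ENNReal.ofReal_le_ofReal (div_le_div_of_nonneg_right hA1 hqpos.le)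

/-! ## §3  On the blow-up branch: the crux clause, and the reshaped stub -/

/-- **Morrey-Type-I + Type-I dissipation ⇒ the crux clause `K₃(1)` near `T`** for a frame blow-up (with the
landed stub 1 of line `pace`, `effSatNear_of_blowup_of_l3Slow`). -/
theorem effSatNear_of_morreyTypeINear_of_dissipationTypeI (hν : 0 < ν) (hT : 0 < T)
    (hsol : IsClassicalNSSolutionOn (Ico 0 T) ν 0 u p) (hLH : IsLerayHopfOn T ν 0 (u 0) u)
    (hdec : HasRapidSpatialDecay (u 0)) (hnext : ¬ HasSmoothExtensionPast ν 0 u T)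
    (hMor : MorreyTypeINear u T)
    (hD : ∃ D₀ : ℝ, 0 < D₀ ∧ ∃ T₂ < T, ∀ t ∈ Ioo T₂ T,
      ∫⁻ x, ENNReal.ofReal (frobeniusNormSq (fderiv ℝ (u t) x)) ≤ ENNReal.ofReal (D₀ / (T - t))) :
    EffSatNear u T :=
  effSatNear_of_blowup_of_l3Slow hν hT hsol hLH hdec hnext
    (l3Slow_of_morreyTypeINear_of_dissipationTypeI hν hT hsol hLH hMor hD)

/-- **Stub 2 of line `pace` modulo Type-I dissipation** — the registered signature of `stub_morreyTypeI_slow`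
with ONE extra hypothesis (Type-I dissipation on a final window); i.e. the bridge «2b» of the re-cut
stub 2 = «2a: Morrey-Type-I frame blow-ups have Type-I dissipation» ∘ «2b». -/
theorem stub2_of_dissipationTypeI :
    ∀ (ν T : ℝ), 0 < ν → 0 < T →
      ∀ (u : ℝ → EuclideanSpace ℝ (Fin 3) → EuclideanSpace ℝ (Fin 3)) (p : ℝ → EuclideanSpace ℝ (Fin 3) → ℝ),
        IsClassicalNSSolutionOn (Ico 0 T) ν 0 u p → IsLerayHopfOn T ν 0 (u 0) u →
        HasRapidSpatialDecay (u 0) → ¬ HasSmoothExtensionPast ν 0 u T → MorreyTypeINear u T →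
        (∃ D₀ : ℝ, 0 < D₀ ∧ ∃ T₂ < T, ∀ t ∈ Ioo T₂ T,
          ∫⁻ x, ENNReal.ofReal (frobeniusNormSq (fderiv ℝ (u t) x)) ≤ ENNReal.ofReal (D₀ / (T - t))) →
        L3Slow u T :=
  fun _ν _T hν hT _u _p hsol hLH _ _ hMor hD => l3Slow_of_morreyTypeINear_of_dissipationTypeI hν hT hsol hLH hMor hD

end Summit.NavierStokesRegularity.NavierStokesRegularity.Theorems.L3TimeExponentPincerMorreyTypeIDissipationPace

end
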